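import Literature.MathematicalPhysics.QuantumFieldTheory.Balaban1983to89.B9Thm39CinvSandwichQ
import Literature.MathematicalPhysics.QuantumFieldTheory.Balaban1983to89.B9Ineq349Hom
import Literature.MathematicalPhysics.QuantumFieldTheory.Balaban1983to89.B9Cor36CubeSandwichQ
import Literature.MathematicalPhysics.QuantumFieldTheory.Balaban1983to89.B9Eq3105FamThreeCommStepMember
import Literature.MathematicalPhysics.QuantumFieldTheory.Balaban1983to89.B9Thm39CinvUpperL

/-!
# `Balaban1983to89.B9Eq3105FamThreeLocCDiffAtoms` — FAMILY 3 OF (3.105), THE LOCATED `C`-DIFFERENCE WORD `hP3` (D2), FILE F3-B3∕3: THE MEMBER-CARRIER ATOMS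
# of the split `B9Eq3105FamThreeLocCDiffSplit` — (A1) the member resolvent word `conj b((s·Q′*X⁻¹Q′(U))^ℝ)` from the (3.48) block and the block-locality of
# `Q′, Q′*`; (A4) the projection `conj b((Q′*Q′(U))^ℝ)` (sub-row G-B9-LETTERS, GAPS G-B9-05 family 3 (D2); programme FAMTHREE; plan
# `lit-balaban-p33/g104/F3B3-KERNELS-PLAN.md`)

statement-level skeleton of published theorems with citation tags; proofs where landed; nothing here is a claim about the Yang–Mills mass gap

THE PRINTED LOCUS (held `paper:balaban1985-cmp99-background-propagators`, journal page = PDF page + 388).  (3.49) p. 399 («For the operator P = I − R we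
obtain, using again Lemma 2.1, …») and the remark after (3.47) p. 398 («It is easy to see that the global inequalities (3.47) are consequences of the local ones
(3.42) and Lemma 2.1.») — OUR GLOSS of the two, not print: a product of operators of this type has the same kind of exponential decay, by Lemma 2.1 of [4];
(3.48) p. 398 (the kernel of `(Q′G′²Q′*)⁻¹`); (3.19)–(3.21) pp. 393–394,
(3.25) p. 394; p. 415 l. 29–37, p. 412 l. 22–36 (where these words are used); [4] = `Balaban1984PropagatorsII`: (2.51)–(2.52) p. 232, (2.14) p. 225, (2.69) p. 235.

WHAT THIS FILE CERTIFIES (kernel-checked; 0 `def`, 0 `def … : Prop`, 0 sorry; standard axioms only)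

* (A1) ★★ `hasMajorant_conj_resolventWord` — `conj b((s·(Q′*(U)∘X⁻¹(U)∘Q′(U)))^ℝ) ≺ (M₂Σ‖b_j‖)²·B₁·ℓ(a)⁻⁴·e^{−δ_Xd}` on `(toB6 (geo9K i) Rr Hp, ιB∘Δ)` from the displayed
  (3.48) block `hCinv : conj b(s·X⁻¹(U)) ≺ B₁ℓ⁻⁴e^{−δ_Xd}` on `(…, ιB)` and bi-contractive `parS(U)` (p21 `hasMajorantHom_conjHom_QpY ∕ _QpsY`, r06
  `hasMajorantHom_local_comp ∕ _comp_local`); `conj_smul_resolventWord_eq` (the coordinate identity).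
* (A4) ★ `hasMajorant_conj_proj` — `conj b((Q′*Q′(U))^ℝ) ≺ 𝟙[a = a′]·(M₂Σ‖b_j‖)²`.

HONEST SCOPE ∕ NOT CLAIMED.  [4] (2.51)-bookkeeping only; the (3.48) block is a HYPOTHESIS (the record's `hCinv`).  Count-neutral; NOT a node discharge; no summit ∕
sub-problem statement is proved; nothing continuum ∕ OS ∕ mass-gap ∕ Clay; YM mass gap NOT proved.  No `sorry`, no `axiom`, no `… : Prop` fact, no `instance`,
no `notation`, no `def`.  NEW file; nothing landed is modified.  Cell `lit-balaban`, seat `lit-balaban-p33` gen 104, 2026-08-29; `--supports stmt-QuantumFields-19200`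
as helper.  Net new unproved facts: 0.

RELATED IN THE TREE, NOT DUPLICATED (searched 2026-08-29: `rg 'resolventWord|hasMajorant_conj_proj\b' Literature/` = ∅): r06 `B9Ineq349Hom.hasMajorantHom_word349₂` (the
five-letter (3.49) word with END letters — F3-B Core's engine; here the bare three-letter resolvent word, reusable inside longer words), p21 `B9Thm39CinvSandwichQ`
(`Q′·[…]·Q′*`, the opposite bracketing) — USED BY NAME.

v1.1 (p33 gen 106, 2026-08-29; DOC-ONLY, declarations byte-identical): (i) page numeral (3.25) → p. 394 (not p. 395; ×3: the printed locus and the cite tags of `hasMajorant_conj_twoWord_local`,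
`hasMajorant_conj_proj`) — text layer PDF p. 6 re-read, [B9] page desk r06 g70 landing sweep №68 of 2026-08-29T04:54:44Z; (ii) the printed-locus line formerly carrying a
stitched sentence inside guillemets now quotes the two printed sentences (p. 399 l. 5, p. 398 l. 25–26) and marks our gloss as a gloss — typer g49 QUOTE-AUDIT
DELTA24a style note S1, lead g35 word of 2026-08-29T06:14:30Z.
-/

noncomputable section

namespace Literature.MathematicalPhysics.QuantumFieldTheory.Balaban1983to89.B9Eq3105FamThreeLocCDiffAtoms

open B6RandomWalk (HasMajorant hasMajorant_mono)
open B6RandomWalkHom (HasMajorantHom hasMajorantHom_mono hasMajorantHom_iff)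
open B9Thm34Ext (toB6)
open B6KLevelCensusIndexV1 (KIdx)
open B6Geom246MultiLevelBox (blkOf)
open B6Ineq2142KLevelV1 (β)
open B9GeoNormsKLevelV1 (geo9K)
open B9Eq352DivFormLetters (conj conj_mul)
open B9Eq376POneLetters (conjHom conjHom_comp conjHom_eq_conj)
open B9Ineq349Hom (hasMajorantHom_local_comp hasMajorantHom_comp_local)
open B9Thm39CinvSandwichQ (hasMajorantHom_conjHom_QpY hasMajorantHom_conjHom_QpsY)
open Node00 (SiteY BlkY IBondY CfgY GaugeY SiteParY SiteOpY toKT QpY QpsY XinvY parSymY parSymY_isGaugeLawS gaugeY gSiteY conjY Intw)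
open B6Cover236MultiLevelBlocks (cubes)
open B9Eq360DeltaPrimeACubeY (blkCubeY)
open B9CubeLettersOpsL0 (GpCubeY)
open B9CubeLettersBondOpsL0 (BlkCubeY QpCubeY QpsCubeY XinvCubeY)
open B9CubeGeometryInputs (geoCK)
open B9CubeLettersCovarianceL0 (QpCubeY_cov QpsCubeY_cov XinvCubeY_cov)
open B9Cor36GpCubeLocLetter (conjY_inv_mul_conjY conjY_mul_conjY_inv)
open B9Eq3105FamThreeCommStepMember (GpCubeY_gauge_inv_eq)

variable {d ℓ : ℕ} {hd : 1 ≤ d + 1} {hL : Odd (ℓ + 1) ∧ 1 < ℓ + 1} {b₀ b₁ : ℝ}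
variable {𝔸 : Type} [NormedRing 𝔸] [NormedAlgebra ℂ 𝔸] [CompleteSpace 𝔸]
variable {ι : Type} [Fintype ι]
variable (i : KIdx d ℓ hd hL b₀ b₁) (b : Module.Basis ι ℝ 𝔸)

/-! ## §0  Generic: a kernel letter between two block-local letters, in coordinates -/

section Generic

variable {g : B9.Geometry} [Fintype g.Site] [DecidableEq g.Site] {Rr : ℝ} {Hp : Prop}
variable {S Y : Type}

omit [CompleteSpace 𝔸] [Fintype g.Site] [DecidableEq g.Site] in
/-- coordinates of a three-letter word `A·(s·C)·B` with `ℂ`-linear letters: `conj b((s·(A∘C∘B))^ℝ) = conĵA ∘ conj b(s·C^ℝ) ∘ conĵB`.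
[cite: Balaban1984PropagatorsII, (2.51) p.232, bookkeeping] -/
theorem conj_smul_threeWord_eq (A : (Y → 𝔸) →ₗ[ℂ] (S → 𝔸)) (C : (Y → 𝔸) →ₗ[ℂ] (Y → 𝔸)) (B : (S → 𝔸) →ₗ[ℂ] (Y → 𝔸)) (s : ℝ) :
    conj b ((s • (A ∘ₗ C ∘ₗ B)).restrictScalars ℝ) = conjHom b (A.restrictScalars ℝ) ∘ₗ conj b (s • C.restrictScalars ℝ) ∘ₗ conjHom b (B.restrictScalars ℝ) := by
  have e : (s • (A ∘ₗ C ∘ₗ B)).restrictScalars ℝ = A.restrictScalars ℝ ∘ₗ (s • C.restrictScalars ℝ) ∘ₗ B.restrictScalars ℝ := by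
    refine LinearMap.ext fun v => ?_
    simp only [LinearMap.restrictScalars_apply, LinearMap.smul_apply, LinearMap.comp_apply, LinearMap.map_smul_of_tower]
  rw [e, ← conjHom_eq_conj, ← conjHom_eq_conj, ← conjHom_comp, ← conjHom_comp]

omit [CompleteSpace 𝔸] [Fintype g.Site] [DecidableEq g.Site] in
/-- coordinates of a two-letter word `A·B`: `conj b((A∘B)^ℝ) = conĵA ∘ conĵB`. [cite: Balaban1984PropagatorsII, (2.51) p.232, bookkeeping] -/
theorem conj_twoWord_eq (A : (Y → 𝔸) →ₗ[ℂ] (S → 𝔸)) (B : (S → 𝔸) →ₗ[ℂ] (Y → 𝔸)) :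
    conj b ((A ∘ₗ B).restrictScalars ℝ) = conjHom b (A.restrictScalars ℝ) ∘ₗ conjHom b (B.restrictScalars ℝ) := by
  rw [← conjHom_eq_conj, LinearMap.restrictScalars_comp, ← conjHom_comp]

omit [CompleteSpace 𝔸] in
/-- ★ **A KERNEL LETTER BETWEEN TWO BLOCK-LOCAL LETTERS** ([4] (2.52) with `K(y,y′) = 𝟙[y = y′]` on both sides): if `conĵA`, `conĵB` are block-local with norm `κ ≥ 0`
between the carriers `blkS` (sites) and `blkY` (blocks) and `conj b(s·C^ℝ) ≺ K ≥ 0` on `blkY`, then `conj b((s·A∘C∘B)^ℝ) ≺ κ²·K` on `blkS`.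
[cite: Balaban1985BackgroundPropagators, (3.49) p.399, remark after (3.47) p.398, (3.19) p.393; Balaban1984PropagatorsII, (2.51)–(2.52) p.232] -/
theorem hasMajorant_conj_threeWord_local (blkS : S × ι → g.Site) (blkY : Y × ι → g.Site)
    (A : (Y → 𝔸) →ₗ[ℂ] (S → 𝔸)) (C : (Y → 𝔸) →ₗ[ℂ] (Y → 𝔸)) (B : (S → 𝔸) →ₗ[ℂ] (Y → 𝔸)) (s : ℝ) {κ : ℝ} (hκ : 0 ≤ κ)
    {K : g.Site → g.Site → ℝ} (hK : ∀ a a', 0 ≤ K a a')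
    (hA : HasMajorantHom (g := toB6 g Rr Hp) blkY blkS (conjHom b (A.restrictScalars ℝ)) (fun a a' : g.Site => if a = a' then κ else 0))
    (hB : HasMajorantHom (g := toB6 g Rr Hp) blkS blkY (conjHom b (B.restrictScalars ℝ)) (fun a a' : g.Site => if a = a' then κ else 0))
    (hC : HasMajorant (g := toB6 g Rr Hp) blkY (conj b (s • C.restrictScalars ℝ)) K) :
    HasMajorant (g := toB6 g Rr Hp) blkS (conj b ((s • (A ∘ₗ C ∘ₗ B)).restrictScalars ℝ)) (fun a a' => κ ^ 2 * K a a') := by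
  have hC' : HasMajorantHom (g := toB6 g Rr Hp) blkY blkY (conj b (s • C.restrictScalars ℝ)) K := (hasMajorantHom_iff (g := toB6 g Rr Hp) _ _ _).2 hC
  have h1 := hasMajorantHom_comp_local (g := g) (R := Rr) (H := Hp) blkS blkY blkY κ hκ hC' hB
  have h2 := hasMajorantHom_local_comp (g := g) (R := Rr) (H := Hp) blkS blkY blkS κ (fun a a' => mul_nonneg (hK a a') hκ) hA h1
  rw [conj_smul_threeWord_eq]
  exact hasMajorant_mono (g := toB6 g Rr Hp) _ ((hasMajorantHom_iff (g := toB6 g Rr Hp) _ _ _).1 h2) fun a a' => le_of_eq (by ring)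

omit [CompleteSpace 𝔸] in
/-- ★ **TWO BLOCK-LOCAL LETTERS** (the projections `Q′*Q′`): `conj b((A∘B)^ℝ) ≺ 𝟙[a = a′]·κ²`. [cite: Balaban1985BackgroundPropagators, (3.19)–(3.21) pp.393–394, (3.25) p.394; Balaban1984PropagatorsII, (2.51)–(2.52) p.232] -/
theorem hasMajorant_conj_twoWord_local (blkS : S × ι → g.Site) (blkY : Y × ι → g.Site)
    (A : (Y → 𝔸) →ₗ[ℂ] (S → 𝔸)) (B : (S → 𝔸) →ₗ[ℂ] (Y → 𝔸)) {κ : ℝ} (hκ : 0 ≤ κ)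
    (hA : HasMajorantHom (g := toB6 g Rr Hp) blkY blkS (conjHom b (A.restrictScalars ℝ)) (fun a a' : g.Site => if a = a' then κ else 0))
    (hB : HasMajorantHom (g := toB6 g Rr Hp) blkS blkY (conjHom b (B.restrictScalars ℝ)) (fun a a' : g.Site => if a = a' then κ else 0)) :
    HasMajorant (g := toB6 g Rr Hp) blkS (conj b ((A ∘ₗ B).restrictScalars ℝ)) (fun a a' : g.Site => if a = a' then κ ^ 2 else 0) := by
  have hKB : ∀ a a' : g.Site, 0 ≤ (if a = a' then κ else 0) := fun a a' => by split_ifs <;> [exact hκ; exact le_rfl]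
  have h2 := hasMajorantHom_local_comp (g := g) (R := Rr) (H := Hp) blkS blkY blkS κ hKB hA hB
  rw [conj_twoWord_eq]
  exact hasMajorant_mono (g := toB6 g Rr Hp) _ ((hasMajorantHom_iff (g := toB6 g Rr Hp) _ _ _).1 h2) fun a a' => le_of_eq (by
    split_ifs <;> ring)

end Generic

/-! ## (A1) The member words `Q′*X⁻¹Q′(U)` and `Q′*Q′(U)` on the site carrier -/

section Member

variable [Fintype (geo9K i).Site] [DecidableEq (geo9K i).Site] {Rr : ℝ} {Hp : Prop}
variable (ιB : BlkY i → IBondY i) (parS : SiteParY 𝔸 i) (Gp : SiteOpY 𝔸 i) (U : CfgY 𝔸 i)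

/-- ★★ **THE MEMBER RESOLVENT WORD `Q′*X⁻¹Q′(U)` ON THE SITE CARRIER**: from the (3.48) block `conj b(s·X⁻¹(U)) ≺ B₁ℓ(a)⁻⁴e^{−δ_Xd}` on the block carrier and the
block-locality of `Q′(U)`, `Q′*(U)` (bi-contractive transporters), `conj b((s·Q′*X⁻¹Q′(U))^ℝ) ≺ (M₂Σ‖b_j‖)²B₁·ℓ(a)⁻⁴·e^{−δ_Xd}` on the site carrier
(block map `z ↦ ιB(Δ(z))`). [cite: Balaban1985BackgroundPropagators, (3.48) p.398, (3.49) p.399, remark after (3.47) p.398, (3.19)–(3.21) pp.393–394; Balaban1984PropagatorsII, (2.51)–(2.52) p.232] -/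
theorem hasMajorant_conj_resolventWord (hpar : ∀ z w : SiteY i, ‖(parS U z w : 𝔸)‖ ≤ 1 ∧ ‖(((parS U z w)⁻¹ : 𝔸ˣ) : 𝔸)‖ ≤ 1)
    {M₂ : ℝ} (hM₂ : 0 ≤ M₂) (hrepr : ∀ (v : 𝔸) (j : ι), |b.repr v j| ≤ M₂ * ‖v‖) {s B₁ δX : ℝ} (hB₁ : 0 ≤ B₁)
    (hCinv : HasMajorant (g := toB6 (geo9K i) Rr Hp) (fun q : BlkY i × ι => ιB q.1) (conj b (s • (XinvY i parS Gp U).restrictScalars ℝ))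
      (fun a a' => B₁ * ((geo9K i).len a ^ 4)⁻¹ * Real.exp (-(δX * (geo9K i).dist a a')))) :
    HasMajorant (g := toB6 (geo9K i) Rr Hp) (fun p : SiteY i × ι => ιB (blkOf i.D.toDomains p.1))
      (conj b ((s • (QpsY i parS U ∘ₗ XinvY i parS Gp U ∘ₗ QpY i parS U)).restrictScalars ℝ))
      (fun a a' => (M₂ * ∑ j, ‖b j‖) ^ 2 * B₁ * ((geo9K i).len a ^ 4)⁻¹ * Real.exp (-(δX * (geo9K i).dist a a'))) := by
  have hκ : 0 ≤ M₂ * ∑ j, ‖b j‖ := mul_nonneg hM₂ (Finset.sum_nonneg fun j _ => norm_nonneg _)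
  have hK : ∀ a a' : (geo9K i).Site, 0 ≤ B₁ * ((geo9K i).len a ^ 4)⁻¹ * Real.exp (-(δX * (geo9K i).dist a a')) := fun a a' =>
    mul_nonneg (mul_nonneg hB₁ (inv_nonneg.2 (pow_nonneg (B6KLevelCensusIndexV1.len_pos i a).le _))) (Real.exp_nonneg _)
  exact hasMajorant_mono (g := toB6 (geo9K i) Rr Hp) _
    (hasMajorant_conj_threeWord_local (g := geo9K i) (Rr := Rr) (Hp := Hp) b _ _ _ _ _ s hκ hK
      (hasMajorantHom_conjHom_QpsY i b ιB parS U (Rr := Rr) (Hp := Hp) hpar hM₂ hrepr)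
      (hasMajorantHom_conjHom_QpY i b ιB parS U (Rr := Rr) (Hp := Hp) hpar hM₂ hrepr) hCinv) fun a a' => le_of_eq (by ring)

/-- ★ **THE MEMBER PROJECTION `Q′*Q′(U)` ON THE SITE CARRIER**: `conj b((Q′*Q′(U))^ℝ) ≺ 𝟙[a = a′]·(M₂Σ‖b_j‖)²`. [cite: Balaban1985BackgroundPropagators, (3.19)–(3.21) pp.393–394, (3.25) p.394; Balaban1984PropagatorsII, (2.51)–(2.52) p.232] -/
theorem hasMajorant_conj_proj (hpar : ∀ z w : SiteY i, ‖(parS U z w : 𝔸)‖ ≤ 1 ∧ ‖(((parS U z w)⁻¹ : 𝔸ˣ) : 𝔸)‖ ≤ 1)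
    {M₂ : ℝ} (hM₂ : 0 ≤ M₂) (hrepr : ∀ (v : 𝔸) (j : ι), |b.repr v j| ≤ M₂ * ‖v‖) :
    HasMajorant (g := toB6 (geo9K i) Rr Hp) (fun p : SiteY i × ι => ιB (blkOf i.D.toDomains p.1))
      (conj b ((QpsY i parS U ∘ₗ QpY i parS U).restrictScalars ℝ)) (fun a a' : (geo9K i).Site => if a = a' then (M₂ * ∑ j, ‖b j‖) ^ 2 else 0) :=
  hasMajorant_conj_twoWord_local (g := geo9K i) (Rr := Rr) (Hp := Hp) b _ _ _ _ (mul_nonneg hM₂ (Finset.sum_nonneg fun _ _ => norm_nonneg _))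
    (hasMajorantHom_conjHom_QpsY i b ιB parS U (Rr := Rr) (Hp := Hp) hpar hM₂ hrepr)
    (hasMajorantHom_conjHom_QpY i b ιB parS U (Rr := Rr) (Hp := Hp) hpar hM₂ hrepr)

end Member

/-! ## (A2) The cube sequence's words `Q′*_□X_□⁻¹Q′_□(V)` and `Q′*_□Q′_□(V)` on the cube site carrier, and their covariance to `V′ = Ṽ^{u⁻¹}` -/

section Cube

variable (c : ↥(cubes (toKT i).D.toDomains)) {Rr : ℝ} {Hp : Prop} (parS : SiteParY 𝔸 i) (V : CfgY 𝔸 i)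

/-- ★★ **THE CUBE RESOLVENT WORD `Q′*_□X_□⁻¹Q′_□(V)` ON THE CUBE SITE CARRIER** from a (3.48) block of `X_□⁻¹(V)` (any kernel `K ≥ 0`) and block-local cube `Q′_□`, `Q′*_□`
of norm `κ_Q` (the shapes of `B9Cor36CinvCubeAtLocCfg.cinv_cube_at_locCfg`): `conj b((s·Q′*_□X_□⁻¹Q′_□(V))^ℝ) ≺ κ_Q²·K` on `(toB6 (geoCK i □) Rr H, Δ_□)`.
[cite: Balaban1985BackgroundPropagators, (3.48) p.398, (3.49) p.399, p.409 l.1–5, Cor. 3.6 p.408; Balaban1984PropagatorsII, (2.51)–(2.52) p.232] -/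
theorem hasMajorant_conj_resolventWord_cube (s : ℝ) {κQ : ℝ} (hκQ : 0 ≤ κQ) {K : BlkCubeY i c → BlkCubeY i c → ℝ} (hK : ∀ a a', 0 ≤ K a a')
    (hQ : HasMajorantHom (g := toB6 (geoCK i c) Rr Hp) (fun p : SiteY i × ι => blkCubeY i c p.1) (fun q : BlkCubeY i c × ι => q.1)
      (conjHom b ((QpCubeY i c parS V).restrictScalars ℝ)) (fun a a' : BlkCubeY i c => if a = a' then κQ else 0))
    (hQs : HasMajorantHom (g := toB6 (geoCK i c) Rr Hp) (fun q : BlkCubeY i c × ι => q.1) (fun p : SiteY i × ι => blkCubeY i c p.1)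
      (conjHom b ((QpsCubeY i c parS V).restrictScalars ℝ)) (fun a a' : BlkCubeY i c => if a = a' then κQ else 0))
    (hC : HasMajorant (g := toB6 (geoCK i c) Rr Hp) (fun q : BlkCubeY i c × ι => q.1) (conj b (s • (XinvCubeY i c parS V).restrictScalars ℝ)) K) :
    HasMajorant (g := toB6 (geoCK i c) Rr Hp) (fun p : SiteY i × ι => blkCubeY i c p.1)
      (conj b ((s • (QpsCubeY i c parS V ∘ₗ XinvCubeY i c parS V ∘ₗ QpCubeY i c parS V)).restrictScalars ℝ)) (fun a a' => κQ ^ 2 * K a a') :=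
  hasMajorant_conj_threeWord_local (g := geoCK i c) (Rr := Rr) (Hp := Hp) b _ _ _ _ _ s hκQ hK hQs hQ hC

/-- ★ **THE CUBE PROJECTION `Q′*_□Q′_□(V)`**: `conj b((Q′*_□Q′_□(V))^ℝ) ≺ 𝟙[a = a′]·κ_Q²` on the cube site carrier. [cite: Balaban1985BackgroundPropagators, (3.19)–(3.21) pp.393–394, p.409 l.1–5; Balaban1984PropagatorsII, (2.51)–(2.52) p.232] -/
theorem hasMajorant_conj_projCube {κQ : ℝ} (hκQ : 0 ≤ κQ)
    (hQ : HasMajorantHom (g := toB6 (geoCK i c) Rr Hp) (fun p : SiteY i × ι => blkCubeY i c p.1) (fun q : BlkCubeY i c × ι => q.1)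
      (conjHom b ((QpCubeY i c parS V).restrictScalars ℝ)) (fun a a' : BlkCubeY i c => if a = a' then κQ else 0))
    (hQs : HasMajorantHom (g := toB6 (geoCK i c) Rr Hp) (fun q : BlkCubeY i c × ι => q.1) (fun p : SiteY i × ι => blkCubeY i c p.1)
      (conjHom b ((QpsCubeY i c parS V).restrictScalars ℝ)) (fun a a' : BlkCubeY i c => if a = a' then κQ else 0)) :
    HasMajorant (g := toB6 (geoCK i c) Rr Hp) (fun p : SiteY i × ι => blkCubeY i c p.1)
      (conj b ((QpsCubeY i c parS V ∘ₗ QpCubeY i c parS V).restrictScalars ℝ)) (fun a a' : BlkCubeY i c => if a = a' then κQ ^ 2 else 0) :=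
  hasMajorant_conj_twoWord_local (g := geoCK i c) (Rr := Rr) (Hp := Hp) b _ _ _ _ hκQ hQs hQ

/-- (3.33) for the cube resolvent word at the gauged-back field: `Q′*_□X_□⁻¹Q′_□(Ṽ^{u⁻¹}) = R(u)⁻¹·Q′*_□X_□⁻¹Q′_□(Ṽ)·R(u)`.
[cite: Balaban1985BackgroundPropagators, (3.31)–(3.33) pp.395–396, p.409 l.3–5] -/
theorem resolventWordCube_gauge_inv_eq (g : GaugeY 𝔸 i) :
    (QpsCubeY i c (parSymY i) (gaugeY i g⁻¹ V) ∘ₗ XinvCubeY i c (parSymY i) (gaugeY i g⁻¹ V) ∘ₗ QpCubeY i c (parSymY i) (gaugeY i g⁻¹ V) :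
        Module.End ℂ (SiteY i → 𝔸)) =
      conjY (gSiteY i g)⁻¹ * (QpsCubeY i c (parSymY i) V ∘ₗ XinvCubeY i c (parSymY i) V ∘ₗ QpCubeY i c (parSymY i) V) * conjY (gSiteY i g) := by
  have h : (QpsCubeY i c (parSymY i) (gaugeY i g⁻¹ V) ∘ₗ XinvCubeY i c (parSymY i) (gaugeY i g⁻¹ V) ∘ₗ QpCubeY i c (parSymY i) (gaugeY i g⁻¹ V)) *
        conjY (gSiteY i g)⁻¹ =
      conjY (gSiteY i g)⁻¹ * (QpsCubeY i c (parSymY i) V ∘ₗ XinvCubeY i c (parSymY i) V ∘ₗ QpCubeY i c (parSymY i) V) :=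
    (QpsCubeY_cov c g⁻¹ V (parSymY_isGaugeLawS i)).comp ((XinvCubeY_cov c (g := g⁻¹) (U := V) (parSymY_isGaugeLawS i)).comp (QpCubeY_cov c g⁻¹ V (parSymY_isGaugeLawS i)))
  rw [← h, mul_assoc, conjY_inv_mul_conjY, mul_one]

/-- (3.33) for the cube's squared propagator: `G′_□(Ṽ^{u⁻¹})² = R(u)⁻¹·G′_□(Ṽ)²·R(u)`. [cite: Balaban1985BackgroundPropagators, (3.33) p.396, p.409 l.3–5] -/
theorem GpCubeY_sq_gauge_inv_eq (g : GaugeY 𝔸 i) :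
    GpCubeY i c (parSymY i) (gaugeY i g⁻¹ V) * GpCubeY i c (parSymY i) (gaugeY i g⁻¹ V) =
      conjY (gSiteY i g)⁻¹ * (GpCubeY i c (parSymY i) V * GpCubeY i c (parSymY i) V) * conjY (gSiteY i g) := by
  rw [GpCubeY_gauge_inv_eq i c (parSymY_isGaugeLawS i) g V]
  calc conjY (gSiteY i g)⁻¹ * GpCubeY i c (parSymY i) V * conjY (gSiteY i g) * (conjY (gSiteY i g)⁻¹ * GpCubeY i c (parSymY i) V * conjY (gSiteY i g))
        = conjY (gSiteY i g)⁻¹ * GpCubeY i c (parSymY i) V * (conjY (gSiteY i g) * conjY (gSiteY i g)⁻¹) * GpCubeY i c (parSymY i) V * conjY (gSiteY i g) := by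
          noncomm_ring
    _ = _ := by rw [conjY_mul_conjY_inv, mul_one]; noncomm_ring

end Cube


/-! ## (A3) The squared propagator `(η²O)(η²O)` from one (3.42)₀ entry (member `K = G′(U)²` or cube `K_□ = G′_□²`, any geometry) -/

section Square

variable {g : B9.Geometry} [Fintype g.Site] {Rr : ℝ} {Hp : Prop} {X : Type}

omit [CompleteSpace 𝔸] in
/-- ★ **THE SQUARED LETTER**: `conj b(r·O) ≺ A·w(a)·e^{−δd}` ⟹ `conj b((r·r)·(O·O)) ≺ A²Cc₁·w(a)²·e^{−(1−α′)(1−α_st)δ·d}` ([4] (2.52) with the scale transfer of `w`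
and (2.61)) — r05's `hasMajorant_mul_weighted` read for one letter twice. [cite: Balaban1985BackgroundPropagators, (3.42) p.397, (3.49) p.399, remark after (3.47) p.398; Balaban1984PropagatorsII, (2.52) p.232, (2.60)–(2.61) p.234] -/
theorem hasMajorant_conj_sq (blk : X × ι → g.Site) (O : Module.End ℝ (X → 𝔸)) (r : ℝ) (dB : ℕ) {A δ αst α' C : ℝ} (w : g.Site → ℝ)
    (hA : 0 ≤ A) (hC : 0 ≤ C) (hw : ∀ a, 0 ≤ w a) (hαδ : 0 ≤ αst * δ) (hα'0 : 0 ≤ α') (hα'1 : α' ≤ 1) (hδ' : 0 ≤ (1 - αst) * δ)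
    (htri : B6RandomWalk.Triangle254 (toB6 g Rr Hp)) (hdnn : ∀ a a' : g.Site, 0 ≤ g.dist a a')
    (hST : B9Ineq347.ScaleTransfer g δ αst C w) (h261 : B6RandomWalk.Ineq261 dB (toB6 g Rr Hp) ((1 - αst) * δ) α')
    (hO : HasMajorant (g := toB6 g Rr Hp) blk (conj b (r • O)) (fun a a' => A * w a * Real.exp (-(δ * g.dist a a')))) :
    HasMajorant (g := toB6 g Rr Hp) blk (conj b ((r * r) • (O * O)))
      (fun a a' => A * A * C * B6.c1 dB ((1 - αst) * δ) α' * (w a * w a) * Real.exp (-((1 - α') * ((1 - αst) * δ) * g.dist a a'))) := by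
  have e : (r * r) • (O * O) = (r • O) * (r • O) := by rw [smul_mul_smul_comm]
  rw [e, B9Eq352DivFormLetters.conj_mul]
  exact B9Thm39CinvUpperL.hasMajorant_mul_weighted (g := g) (R := Rr) (H := Hp) blk dB w w hA hA hC hw hw hαδ hα'0 hα'1 hδ' htri hdnn hST h261 hO hO

end Square

end Literature.MathematicalPhysics.QuantumFieldTheory.Balaban1983to89.B9Eq3105FamThreeLocCDiffAtoms

end
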